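import Summits.BirchSwinnertonDyer.Rank1Residual.X2.NonsplitControlAtoms
import Summits.BirchSwinnertonDyer.Rank1Residual.X2.NonsplitNoTorsion
import HarnessLib

/-!
# Class X2 at ANY multiplicative prime WITHOUT LOCAL `p`-TORSION (`¬split ∨ p ∤ v_p(Δ_min)`): no
# `p`-torsion over `K`, none up the anticyclotomic tower, injectivity / bijectivity of the control map,
# and the Poitou–Tate atoms (P9), (L10) — the bricks of the anticyclotomic control theorem, SIGN-FREE
# (cell `bsd-eis`, seat `bsd-eis-cgshw` g8; route `EisensteinPrimes`, crux 4 `BSDpOnCellC` =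
# stmt-BirchSwinnertonDyer-19034, line b1, stub `stub_ctl_split`; THEOREMS ONLY)

HONEST FRAMING (cell `bsd-eis`, run/shared/lean/pub/bsd-eis/): theorems only; nothing booked; X2 stays
CONSTRUCTION-SHAPED; no label or count moves. The non-split control port (`X2/NonsplitNoTorsion.lean`,
`X2/NonsplitControlAtoms.lean`, cgshw gen 0–2) used the sign hypothesis `¬ split` in exactly ONE way:
`E(ℚ_p)[p] = 0` (`X11b.LocalTorsion.localTorsion_eq_zero_of_nonsplit`). The tree's
`X11b.LocalTorsion.localTorsion_eq_zero_of_mult` proves the same vanishing under the weaker,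
SIGN-FREE hypothesis `¬ split ∨ p ∤ v_p(Δ_min(E))` (Tate curve: at a split `p ≥ 3`, a rational
`p`-torsion point over `ℚ_p` forces `q_E ∈ (ℚ_p^×)^p`, in particular `p ∣ v_p(q_E) = v_p(Δ_min)`;
Silverman VII.6.1 / Ex. 3.5). This file re-runs the eleven bricks VERBATIM with that hypothesis
(`…_of_noLocalPTorsion`), so that the control theorem — and hence the registered stub
`stub_ctl_split : ∀ W p, CellC W p → split → SplitControlOnTree W p` — is a THEOREM on the sub-row
`p ∤ v_p(Δ_min)` = `p ∤ c_p(E)` of the split X2c cells (next file `X2/MultControlNoLocalTorsion.lean`).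
The residual of CTL-split after this is the sub-row `p ∣ c_p(E)` (where `E(ℚ_p)[p]` may be non-zero:
MEMO-7 §2c (I1)–(I6) with torsion).

References: [SilvermanAEC2009] VII.6.1, Ex. 3.5, C.14; [GreenbergLNM1716] §3 Lemma 3.1, §4;
[JetchevSkinnerWan2017] §3.3; [Castella2018] Thm. 2.3; [Castella2018Erratum] Lemma 2.1; [MilneADT2006]
I.2.8, I.4.10; [Brink2007] Thm. 2; cgshw MEMO-2 Addendum A, MEMO-7 §2c.
-/

set_option autoImplicit false

noncomputable section

open scoped Classical

open WeierstrassCurve NumberField IsDedekindDomain Field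
open Literature.NumberTheory.EllipticCurves Literature.NumberTheory.EllipticCurves.GreenbergSelmer
  Literature.NumberTheory.EllipticCurves.ModularForms
  Literature.NumberTheory.EllipticCurves.Rank1Residual
  Literature.NumberTheory.EllipticCurves.Rank1Residual.Typed
  Literature.NumberTheory.GaloisRepresentations Literature.NumberTheory.GaloisCohomology
  Literature.NumberTheory.Automorphic
  Summit.BirchSwinnertonDyer.Rank1Residual.X11b.AcSelmer
  Summit.BirchSwinnertonDyer.Rank1Residual.X11b.LocBridge
  Summit.BirchSwinnertonDyer.Rank1Residual.X11b

namespace Summit.BirchSwinnertonDyer.Rank1Residual.X2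

variable (W : WeierstrassCurve ℚ) [W.IsElliptic] [W.IsGloballyMinimal] (p : ℕ) [Fact p.Prime]

/-- **Local-torsion-free form of `forall_torsion_baseChange_eq_zero_of_not_split`** (`X2/NonsplitNoTorsion.lean`, cgshw; non-split) —
the same statement and proof VERBATIM with the sign hypothesis `hns : ¬ split` replaced by
`hlt : ¬ split ∨ p ∤ v_p(Δ_min)`, whose only use is `E(ℚ_p)[p] = 0`
(`X11b.LocalTorsion.localTorsion_eq_zero_of_mult`, Silverman VII.6.1 / Ex. 3.5 and the Tate
parametrisation: at a SPLIT `p ≥ 3`, `E(ℚ_p)[p] ≠ 0` forces `p ∣ v_p(q_E) = v_p(Δ_min)`).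
[cite: SilvermanAEC2009, VII.3 Prop. 3.1, Thm. VII.6.1 and Exercise 3.5] -/
theorem forall_torsion_baseChange_eq_zero_of_noLocalPTorsion (hp3 : 3 ≤ p) (hmult : Mult W p)
    (hlt : ¬ W.HasSplitMultiplicativeReductionAtPrime p ∨
      ¬ p ∣ padicValInt p W.minimalDiscriminantInt)
    (K : Type) [Field K] [NumberField K] (𝔭 : HeightOneSpectrum (𝓞 K))
    (h𝔭 : ((p : ℕ) : 𝓞 K) ∈ 𝔭.asIdeal) (he : 𝔭.asIdeal.ramificationIdx (𝓞 ℚ) = 1)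
    (hf : 𝔭.asIdeal.inertiaDeg (𝓞 ℚ) = 1) :
    ∀ P : (W.baseChange K).toAffine.Point, p • P = 0 → P = 0 := by
  intro P hP
  set ιp := X11b.embAt K p 𝔭 h𝔭 he hf with hιp
  set f : (W.baseChange K).toAffine.Point →+ (W.baseChange ℚ_[p]).toAffine.Point :=
    Affine.Point.map (W' := W) ιp.toRatAlgHom with hfdef
  have hfinj : Function.Injective f := Affine.Point.map_injective (W' := W) ιp.toRatAlgHom
  have h0 : f P = 0 :=
    X11b.LocalTorsion.localTorsion_eq_zero_of_mult W p hp3 hmult hlt (f P)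
      (by rw [← map_nsmul, hP, map_zero])
  exact (injective_iff_map_eq_zero f).mp hfinj P h0

/-- **Local-torsion-free form of `fixedPoints_kerSubgroup_eq_bot_of_not_split`** (`X2/NonsplitNoTorsion.lean`, cgshw; non-split) —
the same statement and proof VERBATIM with the sign hypothesis `hns : ¬ split` replaced by
`hlt : ¬ split ∨ p ∤ v_p(Δ_min)`, whose only use is `E(ℚ_p)[p] = 0`
(`X11b.LocalTorsion.localTorsion_eq_zero_of_mult`, Silverman VII.6.1 / Ex. 3.5 and the Tate
parametrisation: at a SPLIT `p ≥ 3`, `E(ℚ_p)[p] ≠ 0` forces `p ∣ v_p(q_E) = v_p(Δ_min)`).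
[cite: GreenbergLNM1716, §1 p. 62; §4 p. 109] -/
theorem fixedPoints_kerSubgroup_eq_bot_of_noLocalPTorsion (hp3 : 3 ≤ p) (hmult : Mult W p)
    (hlt : ¬ W.HasSplitMultiplicativeReductionAtPrime p ∨
      ¬ p ∣ padicValInt p W.minimalDiscriminantInt)
    (K : Type) [Field K] [NumberField K] (𝔭 : HeightOneSpectrum (𝓞 K))
    (h𝔭 : ((p : ℕ) : 𝓞 K) ∈ 𝔭.asIdeal) (he : 𝔭.asIdeal.ramificationIdx (𝓞 ℚ) = 1)
    (hf : 𝔭.asIdeal.inertiaDeg (𝓞 ℚ) = 1) (κ : ZpExtension K p) :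
    FixedPoints.addSubgroup κ.kerSubgroup (geomPrimaryTorsion (W.baseChange K) p) = ⊥ := by
  haveI : (W.baseChange K).IsElliptic := by rw [baseChange]; infer_instance
  exact (W.baseChange K).fixedPoints_kerSubgroup_geomPrimaryTorsion_eq_bot κ
    (forall_torsion_baseChange_eq_zero_of_noLocalPTorsion W p hp3 hmult hlt K 𝔭 h𝔭 he hf)

/-- **Local-torsion-free form of `controlMap_injective_of_not_split`** (`X2/NonsplitNoTorsion.lean`, cgshw; non-split) —
the same statement and proof VERBATIM with the sign hypothesis `hns : ¬ split` replaced by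
`hlt : ¬ split ∨ p ∤ v_p(Δ_min)`, whose only use is `E(ℚ_p)[p] = 0`
(`X11b.LocalTorsion.localTorsion_eq_zero_of_mult`, Silverman VII.6.1 / Ex. 3.5 and the Tate
parametrisation: at a SPLIT `p ≥ 3`, `E(ℚ_p)[p] ≠ 0` forces `p ∣ v_p(q_E) = v_p(Δ_min)`).
[cite: GreenbergLNM1716, §3 Lemma 3.1 (p. 86)] [cite: JetchevSkinnerWan2017, §3.3 (control; shape only)] -/
theorem controlMap_injective_of_noLocalPTorsion (hp3 : 3 ≤ p) (hmult : Mult W p)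
    (hlt : ¬ W.HasSplitMultiplicativeReductionAtPrime p ∨
      ¬ p ∣ padicValInt p W.minimalDiscriminantInt)
    (K : Type) [Field K] [NumberField K] (𝔭 : HeightOneSpectrum (𝓞 K))
    (h𝔭 : ((p : ℕ) : 𝓞 K) ∈ 𝔭.asIdeal) (he : 𝔭.asIdeal.ramificationIdx (𝓞 ℚ) = 1)
    (hf : 𝔭.asIdeal.inertiaDeg (𝓞 ℚ) = 1) (κ : ZpExtension K p) {γ₀ : absoluteGaloisGroup K}
    (hγ₀ : κ.IsTopGenerator γ₀) (𝔮 : HeightOneSpectrum (𝓞 K)) (S : Set (HeightOneSpectrum (𝓞 K)))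
    (γ : absoluteGaloisGroup K) :
    Function.Injective (X11b.AcSelmer.controlMap (W.baseChange K) p κ 𝔮 S γ) :=
  X11b.AcSelmer.controlMap_injective_of_fixedPoints_eq_bot hγ₀
    (fixedPoints_kerSubgroup_eq_bot_of_noLocalPTorsion W p hp3 hmult hlt K 𝔭 h𝔭 he hf κ) γ

/-- **Local-torsion-free form of `natCard_selmerAcBase_dvd_of_not_split`** (`X2/NonsplitNoTorsion.lean`, cgshw; non-split) —
the same statement and proof VERBATIM with the sign hypothesis `hns : ¬ split` replaced by
`hlt : ¬ split ∨ p ∤ v_p(Δ_min)`, whose only use is `E(ℚ_p)[p] = 0`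
(`X11b.LocalTorsion.localTorsion_eq_zero_of_mult`, Silverman VII.6.1 / Ex. 3.5 and the Tate
parametrisation: at a SPLIT `p ≥ 3`, `E(ℚ_p)[p] ≠ 0` forces `p ∣ v_p(q_E) = v_p(Δ_min)`).
[cite: JetchevSkinnerWan2017, §3.3 (control; shape only)] -/
theorem natCard_selmerAcBase_dvd_of_noLocalPTorsion (hp3 : 3 ≤ p) (hmult : Mult W p)
    (hlt : ¬ W.HasSplitMultiplicativeReductionAtPrime p ∨
      ¬ p ∣ padicValInt p W.minimalDiscriminantInt)
    (K : Type) [Field K] [NumberField K] (𝔭 : HeightOneSpectrum (𝓞 K))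
    (h𝔭 : ((p : ℕ) : 𝓞 K) ∈ 𝔭.asIdeal) (he : 𝔭.asIdeal.ramificationIdx (𝓞 ℚ) = 1)
    (hf : 𝔭.asIdeal.inertiaDeg (𝓞 ℚ) = 1) (κ : ZpExtension K p) {γ₀ : absoluteGaloisGroup K}
    (hγ₀ : κ.IsTopGenerator γ₀) (𝔮 : HeightOneSpectrum (𝓞 K)) (S : Set (HeightOneSpectrum (𝓞 K)))
    (γ : absoluteGaloisGroup K)
    [Finite (IwasawaDual.endInvariants
      (X11b.AcSelmer.conjSelmerAc (W.baseChange K) p κ 𝔮 S γ - 1))] :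
    Finite (X11b.AcSelmer.selmerAcBase (W.baseChange K) p 𝔮 S) ∧
      Nat.card (X11b.AcSelmer.selmerAcBase (W.baseChange K) p 𝔮 S) ∣
        Nat.card (IwasawaDual.endInvariants
          (X11b.AcSelmer.conjSelmerAc (W.baseChange K) p κ 𝔮 S γ - 1)) :=
  X11b.AcSelmer.natCard_selmerAcBase_dvd_of_injective γ
    (controlMap_injective_of_noLocalPTorsion W p hp3 hmult hlt K 𝔭 h𝔭 he hf κ hγ₀ 𝔮 S γ)

/-- **Local-torsion-free form of `fixedPoints_decomp_inf_kerSubgroup_eq_bot_of_not_split`** (`X2/NonsplitControlAtoms.lean`, cgshw; non-split) —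
the same statement and proof VERBATIM with the sign hypothesis `hns : ¬ split` replaced by
`hlt : ¬ split ∨ p ∤ v_p(Δ_min)`, whose only use is `E(ℚ_p)[p] = 0`
(`X11b.LocalTorsion.localTorsion_eq_zero_of_mult`, Silverman VII.6.1 / Ex. 3.5 and the Tate
parametrisation: at a SPLIT `p ≥ 3`, `E(ℚ_p)[p] ≠ 0` forces `p ∣ v_p(q_E) = v_p(Δ_min)`).
[cite: SilvermanAEC2009, Thm VII.6.1 and Exercise 3.5] [cite: Castella2018Erratum, Lemma 2.1 (pp. 1–2)] -/
theorem fixedPoints_decomp_inf_kerSubgroup_eq_bot_of_noLocalPTorsion (hp3 : 3 ≤ p) (hmult : Mult W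
    p)
    (hlt : ¬ W.HasSplitMultiplicativeReductionAtPrime p ∨
      ¬ p ∣ padicValInt p W.minimalDiscriminantInt)
    (K : Type) [Field K] [NumberField K] (κ : ZpExtension K p) (𝔭 : HeightOneSpectrum (𝓞 K))
    (h𝔭 : ((p : ℕ) : 𝓞 K) ∈ 𝔭.asIdeal) (he : 𝔭.asIdeal.ramificationIdx (𝓞 ℚ) = 1)
    (hf : 𝔭.asIdeal.inertiaDeg (𝓞 ℚ) = 1) :
    FixedPoints.addSubgroup ↥(decomp 𝔭 ⊓ κ.kerSubgroup) ((W.baseChange K).geomPrimaryTorsion p) = ⊥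
        := by
  obtain ⟨e⟩ := exists_ringHom_adicCompletion_padic_of_degreeOne p 𝔭 h𝔭 he hf
  have hKv := noPTorsion_baseChange_adicCompletion_of_padic W p 𝔭 e
    (LocalTorsion.localTorsion_eq_zero_of_mult W p hp3 hmult hlt)
  exact fixedPoints_decomp_inf_kerSubgroup_eq_bot κ (W.baseChange K) 𝔭 fun m hfix hpm ↦
    eq_zero_of_fixed_decomp_of_local (W.baseChange K) p 𝔭 hKv m hfix hpm

/-- **Local-torsion-free form of `noInvariantsAt_of_not_split`** (`X2/NonsplitControlAtoms.lean`, cgshw; non-split) —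
the same statement and proof VERBATIM with the sign hypothesis `hns : ¬ split` replaced by
`hlt : ¬ split ∨ p ∤ v_p(Δ_min)`, whose only use is `E(ℚ_p)[p] = 0`
(`X11b.LocalTorsion.localTorsion_eq_zero_of_mult`, Silverman VII.6.1 / Ex. 3.5 and the Tate
parametrisation: at a SPLIT `p ≥ 3`, `E(ℚ_p)[p] ≠ 0` forces `p ∣ v_p(q_E) = v_p(Δ_min)`).
[cite: Castella2018Erratum, Thm. 1.1 (iv), Lemma 2.1 (pp. 1–2)] -/
theorem noInvariantsAt_of_noLocalPTorsion (hp3 : 3 ≤ p) (hmult : Mult W p)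
    (hlt : ¬ W.HasSplitMultiplicativeReductionAtPrime p ∨
      ¬ p ∣ padicValInt p W.minimalDiscriminantInt)
    (K : Type) [Field K]
    [NumberField K] (κ : ZpExtension K p) (𝔭 : HeightOneSpectrum (𝓞 K))
    (h𝔭 : ((p : ℕ) : 𝓞 K) ∈ 𝔭.asIdeal) (he : 𝔭.asIdeal.ramificationIdx (𝓞 ℚ) = 1)
    (hf : 𝔭.asIdeal.inertiaDeg (𝓞 ℚ) = 1) (Q : (W.baseChange K).geomPrimaryTorsion p)
    (hQ : ∀ σ : absoluteGaloisGroup (𝔭.adicCompletion K),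
      GaloisRep.restrictField (𝔭.adicCompletion K) (primaryGaloisModule (W.baseChange K) p) σ Q =
        Q) : Q = 0 := by
  have h := fixedPoints_decomp_inf_kerSubgroup_eq_bot_of_noLocalPTorsion W p hp3 hmult hlt K κ 𝔭 h𝔭
      he hf
  have hmem : Q ∈ FixedPoints.addSubgroup ↥(decomp 𝔭 ⊓ κ.kerSubgroup)
      ((W.baseChange K).geomPrimaryTorsion p) := by
    refine (FixedPoints.mem_addSubgroup _ _ Q).mpr fun d ↦ ?_
    obtain ⟨σ, hσ⟩ := (mem_decomp_iff 𝔭 _).mp (Subgroup.mem_inf.mp d.2).1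
    have h1 : absGaloisRestrict K (𝔭.adicCompletion K) σ • Q = Q := hQ σ
    rw [hσ] at h1
    exact h1
  rw [h] at hmem
  exact (AddSubgroup.mem_bot).mp hmem

/-- **Local-torsion-free form of `noInvariants_of_not_split`** (`X2/NonsplitControlAtoms.lean`, cgshw; non-split) —
the same statement and proof VERBATIM with the sign hypothesis `hns : ¬ split` replaced by
`hlt : ¬ split ∨ p ∤ v_p(Δ_min)`, whose only use is `E(ℚ_p)[p] = 0`
(`X11b.LocalTorsion.localTorsion_eq_zero_of_mult`, Silverman VII.6.1 / Ex. 3.5 and the Tate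
parametrisation: at a SPLIT `p ≥ 3`, `E(ℚ_p)[p] ≠ 0` forces `p ∣ v_p(q_E) = v_p(Δ_min)`).
[cite: Castella2018Erratum, Thm. 1.1 (iv), Lemma 2.1 (pp. 1–2)] -/
theorem noInvariants_of_noLocalPTorsion (hp3 : 3 ≤ p) (hmult : Mult W p)
    (hlt : ¬ W.HasSplitMultiplicativeReductionAtPrime p ∨
      ¬ p ∣ padicValInt p W.minimalDiscriminantInt)
    (K : Type) [Field K]
    [NumberField K] (κ : ZpExtension K p) (𝔭 : HeightOneSpectrum (𝓞 K))
    (h𝔭 : ((p : ℕ) : 𝓞 K) ∈ 𝔭.asIdeal) (he : 𝔭.asIdeal.ramificationIdx (𝓞 ℚ) = 1)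
    (hf : 𝔭.asIdeal.inertiaDeg (𝓞 ℚ) = 1) (Q : (W.baseChange K).geomPrimaryTorsion p)
    (hQ : ∀ σ : absoluteGaloisGroup K, primaryGaloisModule (W.baseChange K) p σ Q = Q) : Q = 0 := by
  have h := fixedPoints_decomp_inf_kerSubgroup_eq_bot_of_noLocalPTorsion W p hp3 hmult hlt K κ 𝔭 h𝔭
      he hf
  have hmem : Q ∈ FixedPoints.addSubgroup ↥(decomp 𝔭 ⊓ κ.kerSubgroup)
      ((W.baseChange K).geomPrimaryTorsion p) :=
    (FixedPoints.mem_addSubgroup _ _ Q).mpr fun d ↦ hQ (d : absoluteGaloisGroup K)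
  rw [h] at hmem
  exact (AddSubgroup.mem_bot).mp hmem

/-- **Local-torsion-free form of `resSubgroup_kerSubgroup_injective_of_not_split`** (`X2/NonsplitControlAtoms.lean`, cgshw; non-split) —
the same statement and proof VERBATIM with the sign hypothesis `hns : ¬ split` replaced by
`hlt : ¬ split ∨ p ∤ v_p(Δ_min)`, whose only use is `E(ℚ_p)[p] = 0`
(`X11b.LocalTorsion.localTorsion_eq_zero_of_mult`, Silverman VII.6.1 / Ex. 3.5 and the Tate
parametrisation: at a SPLIT `p ≥ 3`, `E(ℚ_p)[p] ≠ 0` forces `p ∣ v_p(q_E) = v_p(Δ_min)`).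
[cite: GreenbergLNM1716, §3 Lemma 3.1 (p. 86)] [cite: SilvermanAEC2009, Thm VII.6.1 and Exercise 3.5] -/
theorem resSubgroup_kerSubgroup_injective_of_noLocalPTorsion (hp3 : 3 ≤ p) (hmult : Mult W p)
    (hlt : ¬ W.HasSplitMultiplicativeReductionAtPrime p ∨
      ¬ p ∣ padicValInt p W.minimalDiscriminantInt)
    (K : Type) [Field K] [NumberField K]
    (𝔭 : HeightOneSpectrum (𝓞 K)) (h𝔭 : ((p : ℕ) : 𝓞 K) ∈ 𝔭.asIdeal)
    (he : 𝔭.asIdeal.ramificationIdx (𝓞 ℚ) = 1) (hf : 𝔭.asIdeal.inertiaDeg (𝓞 ℚ) = 1)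
    (κ : ZpExtension K p) :
    Function.Injective
      (ResKernel.resSubgroup κ.kerSubgroup ((W.baseChange K).geomPrimaryTorsion p)) := by
  obtain ⟨γ, hγ⟩ := κ.surjective (Multiplicative.ofAdd 1)
  haveI : (W.baseChange K).IsElliptic := by rw [baseChange]; infer_instance
  refine resSubgroup_kerSubgroup_injective_of_fixedPoints_eq_bot (W.baseChange K) p κ hγ
    ((W.baseChange K).fixedPoints_kerSubgroup_geomPrimaryTorsion_eq_bot κ fun P hP ↦ ?_)
  have hfinj : Function.Injective
      (Affine.Point.map (W' := W) (embAt K p 𝔭 h𝔭 he hf).toRatAlgHom :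
        (W.baseChange K).toAffine.Point →+ (W.baseChange ℚ_[p]).toAffine.Point) :=
    Affine.Point.map_injective (W' := W) (embAt K p 𝔭 h𝔭 he hf).toRatAlgHom
  refine (injective_iff_map_eq_zero _).mp hfinj P
    (LocalTorsion.localTorsion_eq_zero_of_mult W p hp3 hmult hlt _ ?_)
  rw [← map_nsmul, hP, map_zero]

/-- **Local-torsion-free form of `controlMap_bijective_nPlus_of_not_split`** (`X2/NonsplitControlAtoms.lean`, cgshw; non-split) —
the same statement and proof VERBATIM with the sign hypothesis `hns : ¬ split` replaced by
`hlt : ¬ split ∨ p ∤ v_p(Δ_min)`, whose only use is `E(ℚ_p)[p] = 0`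
(`X11b.LocalTorsion.localTorsion_eq_zero_of_mult`, Silverman VII.6.1 / Ex. 3.5 and the Tate
parametrisation: at a SPLIT `p ≥ 3`, `E(ℚ_p)[p] ≠ 0` forces `p ∣ v_p(q_E) = v_p(Δ_min)`).
[cite: JetchevSkinnerWan2017, §3.3 and Thm. 3.3.1 (shape only)] [cite: GreenbergLNM1716, §3 pp. 85–90] -/
theorem controlMap_bijective_nPlus_of_noLocalPTorsion (hp3 : 3 ≤ p) (hmult : Mult W p)
    (hlt : ¬ W.HasSplitMultiplicativeReductionAtPrime p ∨
      ¬ p ∣ padicValInt p W.minimalDiscriminantInt)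
    {K : Type} [Field K] [NumberField K]
    (hK : IsImaginaryQuadratic K) {κ : ZpExtension K p} (hκ : κ.IsAnticyclotomic)
    {γ : absoluteGaloisGroup K} (hγ : κ.IsTopGenerator γ) (𝔭 : HeightOneSpectrum (𝓞 K))
    (h𝔭 : ((p : ℕ) : 𝓞 K) ∈ 𝔭.asIdeal) (he : 𝔭.asIdeal.ramificationIdx (𝓞 ℚ) = 1)
    (hf : 𝔭.asIdeal.inertiaDeg (𝓞 ℚ) = 1) :
    Function.Bijective (controlMap (W.baseChange K) p κ 𝔭 (nPlusPlaces W K p) γ) := by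
  haveI : IsTotallyComplex K := hK.2
  exact IsAnticyclotomic.controlMap_bijective_of_splitBad_subset (W.baseChange K) p κ 𝔭
    (nPlusPlaces W K p) hK.1 hκ hγ
    (resSubgroup_kerSubgroup_injective_of_noLocalPTorsion W p hp3 hmult hlt K 𝔭 h𝔭 he hf κ)
    (fixedPoints_decomp_inf_kerSubgroup_eq_bot_of_noLocalPTorsion W p hp3 hmult hlt K κ 𝔭 h𝔭 he hf)
    (fun v hpv hbad he1 hf1 ↦ mem_nPlusPlaces_of v hpv
      (primesEquiv_under_dvd_conductorNorm_of_not_hasGoodReductionAt K v hbad) he1 hf1)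

/-- **Local-torsion-free form of `coinvariantsTrivialAt_of_not_split`** (`X2/NonsplitControlAtoms.lean`, cgshw; non-split) —
the same statement and proof VERBATIM with the sign hypothesis `hns : ¬ split` replaced by
`hlt : ¬ split ∨ p ∤ v_p(Δ_min)`, whose only use is `E(ℚ_p)[p] = 0`
(`X11b.LocalTorsion.localTorsion_eq_zero_of_mult`, Silverman VII.6.1 / Ex. 3.5 and the Tate
parametrisation: at a SPLIT `p ≥ 3`, `E(ℚ_p)[p] ≠ 0` forces `p ∣ v_p(q_E) = v_p(Δ_min)`).
[cite: JetchevSkinnerWan2017, Lemma 3.3.3 (arXiv:1512.06894 pp. 11–12)] -/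
theorem coinvariantsTrivialAt_of_noLocalPTorsion (hp3 : 3 ≤ p) (hmult : Mult W p)
    (hlt : ¬ W.HasSplitMultiplicativeReductionAtPrime p ∨
      ¬ p ∣ padicValInt p W.minimalDiscriminantInt)
    {K : Type} [Field K]
    [NumberField K] (hPT : poitouTate_selmerStructure_duality K) (hPT2 : poitouTate_sha_tateDual K)
    (hEP : ∀ v : HeightOneSpectrum (𝓞 K), localEulerPoincareCharacteristic (v.adicCompletion K))
    (hcd : fieldCdLE_two_of_numberField) (hK : IsImaginaryQuadratic K) (hsplit : SplitsIn K p)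
    (κ : ZpExtension K p) {γ : absoluteGaloisGroup K} (hγ : κ.IsTopGenerator γ)
    {𝔭 : HeightOneSpectrum (𝓞 K)} (h𝔭 : ((p : ℕ) : 𝓞 K) ∈ 𝔭.asIdeal)
    (he : 𝔭.asIdeal.ramificationIdx (𝓞 ℚ) = 1) (hf : 𝔭.asIdeal.inertiaDeg (𝓞 ℚ) = 1)
    (hfin : ∀ v : HeightOneSpectrum (𝓞 K), ((p : ℕ) : 𝓞 K) ∈ v.asIdeal →
      Finite (selmerAcBase (W.baseChange K) p v ∅)) :
    CoinvariantsTrivialAt (W.baseChange K) p κ 𝔭 γ := by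
  haveI : IsTotallyComplex K := hK.2
  obtain ⟨σ, 𝔮, -, hne, h𝔮, -⟩ :=
    LocalIndexTransport.exists_conj_prime_of_splitsIn K p hK.1 hsplit h𝔭
  have hΓ𝔭 := noInvariantsAt_of_noLocalPTorsion W p hp3 hmult hlt K κ 𝔭 h𝔭 he hf
  have hΓ := Coinv.noInvariants_of_noInvariants_at (W.baseChange K) p hΓ𝔭
  have htor := exists_pow_nsmul_local_eq_zero W p hK.1 hsplit
  haveI := hfin 𝔭 h𝔭
  have h2 := WeakLeopoldt.subsingleton_galoisCohomology_two_primary (W.baseChange K) p 𝔭 ∅ hPT2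
    (fieldCdLE_two_of_isTotallyComplex hcd K p) hΓ htor
  exact Coinv.coinvariantsTrivialAt_of_subsingleton (W.baseChange K) p κ hPT hEP h𝔭 h𝔮 hne hΓ𝔭
    (hfin 𝔮 h𝔮) h2 hγ

/-- **Local-torsion-free form of `locSurjAt_of_finite_conj_of_not_split`** (`X2/NonsplitControlAtoms.lean`, cgshw; non-split) —
the same statement and proof VERBATIM with the sign hypothesis `hns : ¬ split` replaced by
`hlt : ¬ split ∨ p ∤ v_p(Δ_min)`, whose only use is `E(ℚ_p)[p] = 0`
(`X11b.LocalTorsion.localTorsion_eq_zero_of_mult`, Silverman VII.6.1 / Ex. 3.5 and the Tate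
parametrisation: at a SPLIT `p ≥ 3`, `E(ℚ_p)[p] ≠ 0` forces `p ∣ v_p(q_E) = v_p(Δ_min)`).
[cite: JetchevSkinnerWan2017, Prop. 3.3.2 (arXiv:1512.06894 p. 11)] -/
theorem locSurjAt_of_finite_conj_of_noLocalPTorsion (hp3 : 3 ≤ p) (hmult : Mult W p)
    (hlt : ¬ W.HasSplitMultiplicativeReductionAtPrime p ∨
      ¬ p ∣ padicValInt p W.minimalDiscriminantInt)
    {K : Type} [Field K]
    [NumberField K] (hPT : poitouTate_selmerStructure_duality K)
    (hEP : ∀ v : HeightOneSpectrum (𝓞 K), localEulerPoincareCharacteristic (v.adicCompletion K))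
    (hK : IsImaginaryQuadratic K) (κ : ZpExtension K p) {𝔭 𝔮 : HeightOneSpectrum (𝓞 K)}
    (h𝔭 : ((p : ℕ) : 𝓞 K) ∈ 𝔭.asIdeal) (he : 𝔭.asIdeal.ramificationIdx (𝓞 ℚ) = 1)
    (hf : 𝔭.asIdeal.inertiaDeg (𝓞 ℚ) = 1) (h𝔮 : ((p : ℕ) : 𝓞 K) ∈ 𝔮.asIdeal) (hne : 𝔮 ≠ 𝔭)
    (hfin : Finite (selmerAcBase (W.baseChange K) p 𝔮 ∅)) :
    LocSurjAt (W.baseChange K) p 𝔭 (nPlusPlaces_finite (W := W) (p := p) hK.1) := by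
  haveI : IsTotallyComplex K := hK.2
  haveI := hfin
  have hfin0 : Finite (acStructure (primaryGaloisModule (W.baseChange K) p) p 𝔮
      (∅ : Set (HeightOneSpectrum (𝓞 K)))).selmerGroup := by
    refine Nat.finite_of_card_ne_zero ?_
    rw [← natCard_selmerAcBase_eq_natCard_selmerGroup (W.baseChange K) p 𝔮 ∅]
    exact Nat.card_pos.ne'
  have hfinR : Finite (acStructure (primaryGaloisModule (W.baseChange K) p) p 𝔮
      {v | (Sum.inr v : Place K) ∈ exceptionalPlaces W K p hK.1 ∧
        ((p : ℕ) : 𝓞 K) ∉ v.asIdeal}).selmerGroup :=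
    finite_selmerGroup_acStructure_of_finite_empty _ p 𝔮 _ (finite_relaxationSet hK.1) hfin0
      fun v hv _ ↦ finite_galoisCohomology_one_primary_toLocal (W.baseChange K) p v (hEP v) hv.2
  exact locSurjAt_of_finite (W.baseChange K) p 𝔭 (exceptionalPlaces W K p hK.1) hPT
    (fun w ↦ IsTotallyComplex.isComplex w)
    (fun Q hQ ↦ noInvariants_of_noLocalPTorsion W p hp3 hmult hlt K κ 𝔭 h𝔭 he hf Q hQ) h𝔭 h𝔮 hne
    (nPlusPlaces_finite (W := W) (p := p) hK.1) (fun v hv ↦ hv.1)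
    (inl_mem_exceptionalPlaces hK.1) (fun v hv ↦ inr_mem_exceptionalPlaces_of_mem hK.1 hv)
    (fun v hv ↦ inr_mem_exceptionalPlaces_of_mem_nPlusPlaces hK.1 hv)
    (fun v hv ↦ inr_mem_exceptionalPlaces_of_not_hasGoodReductionAt hK.1 hv) hfinR

end Summit.BirchSwinnertonDyer.Rank1Residual.X2

end
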